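import Literature.Probability.RandomPlanarGeometry.HexSAWLattice
import HarnessLib

/-!
# `c_N(ℍ) ≤ c_{N+4}(ℍ)` on the hexagonal lattice (lane «pcv-sawmu», bet A2 «HEX-RATIO-2», piece K3-ℍ «HEX-PLUS-FOUR»)

Topic `Literature/Probability/RandomPlanarGeometry` (continues `HexSAWLattice.lean`: the coordinate honeycomb `hvGraph`
on `HV = ℤ × ℤ × Bool`, self-avoiding lists `sawLists hvGraph hvOrigin n`, `hexSawCount_eq_card`). Source of the idea:
Madras–Slade, *The Self-Avoiding Walk* (1993), §7.2 Fig. 7.1 (modify a walk at an extremal vertex, injectively);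
the triangular one-step version is `SAWTriangularMonotone.lean` (a-p6), whose list framework (`Dom`/`top`, insertion,
prepend-and-translate) is followed here.

THE ARGUMENT. Grade the honeycomb by the level `lev (x₀, x₁, b) = 2(x₀ + x₁) + [b]`: a vertex `(x, false)` has ONE
upper neighbour `(x, true)` and two lower ones `(x − e₀, true)`, `(x − e₁, true)`; a vertex `(x, true)` has two upper
neighbours `(x + e₀, false)`, `(x + e₁, false)` and one lower one `(x, false)`. Let `u` be the TOP vertex of an
`N`-step self-avoiding list `ω` from the origin (maximal level, then maximal `x₀`). Four cases (`grow4`):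
(i) `u` is the origin (the first vertex): PREPEND the 4-path `O, (−1,0,T), (−1,0,F), (−2,0,T)` and translate `ω` by
`−2e₀` (levels drop by `4`, so the translate lies strictly below the prefix); (ii)/(iii) `u` is the last vertex:
APPEND 4 steps climbing strictly in level; (iv) otherwise `u = (a, false)` is interior with list-neighbours exactly
`(a − e₀, true)` and `(a − e₁, true)` (a top vertex of type `true` has at most one admissible neighbour, so it is an end):
INSERT between `u` and `(a − e₁, true)` the other five edges of the hexagon to the upper right of that edge, i.e. the
4-path `(a,T), (a+e₀,F), (a+e₀−e₁,T), (a+e₀−e₁,F)` — its first three vertices lie above the top level and the fourth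
is on the top level to the RIGHT of `u`, hence all four are fresh. The map is injective because it is decoded by the
top vertex `t` of the image (`ungrow4`): `t` = origin ⇔ (i); `t` = last vertex ⇔ (ii)/(iii); otherwise (iv) with the
inserted hexagon read off `t = (a + e₀, false)`. Hence `c_N(ℍ) ≤ c_{N+4}(ℍ)` (`hexSawCount_le_add_four`), the lane
face `HexPlusFour` (a-idea-1 `Doors_Day3` §C1, verbatim), and the two-step ratio lower bound `HexRatioLower`.
Exact-name discharges `HexPlusFour_holds`, `HexRatioLower_holds` (riders, appended by the lane's literature seat).
[cite: MadrasSlade1993, §7.2 (Fig. 7.1) and §7.1 (7.1.6)] Seat a-p1 gen 5, 2026-08-22.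
-/

noncomputable section

open Finset Filter Topology
open Literature.Probability.LatticeModels Literature.Probability.Percolation SimpleGraph

namespace Literature.Probability.RandomPlanarGeometry.SAW

namespace HexP4

/-! ### §1. The level order and the top vertex -/

/-- The level `2(x₀ + x₁) + [b]`: adjacent vertices of `hvGraph` have levels differing by `1`. [cite: MadrasSlade1993, §7.2 (Fig. 7.1)] -/
def lev (v : HV) : ℤ := 2 * (v.1 + v.2.1) + if v.2.2 then 1 else 0

/-- `v` dominates `w`: lower level, or the same level and not to the right. [cite: MadrasSlade1993, §7.2 (Fig. 7.1)] -/
def Dom (v w : HV) : Prop := lev w < lev v ∨ (lev w = lev v ∧ w.1 ≤ v.1)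

/-- Domination is reflexive. [folklore] -/
private theorem dom_refl (v : HV) : Dom v v := Or.inr ⟨rfl, le_rfl⟩

/-- Domination is total. [folklore] -/
private theorem dom_total (v w : HV) : Dom v w ∨ Dom w v := by
  unfold Dom; omega

/-- Domination is transitive. [folklore] -/
private theorem dom_trans {u v w : HV} (h1 : Dom u v) (h2 : Dom v w) : Dom u w := by
  unfold Dom at *; omega

/-- Domination is antisymmetric. [folklore] -/
private theorem dom_antisymm {v w : HV} (h1 : Dom v w) (h2 : Dom w v) : v = w := by
  obtain ⟨a, b, c⟩ := v
  obtain ⟨a', b', c'⟩ := w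
  unfold Dom lev at h1 h2
  cases c <;> cases c' <;> simp at h1 h2 ⊢ <;> omega

/-- A nonempty list has a dominating member. [folklore] -/
private theorem exists_top (l : List HV) (hl : l ≠ []) : ∃ v ∈ l, ∀ w ∈ l, Dom v w := by
  induction l with
  | nil => exact absurd rfl hl
  | cons a l ih =>
    rcases eq_or_ne l [] with rfl | hl'
    · exact ⟨a, by simp, fun w hw => by simp at hw; subst hw; exact dom_refl _⟩
    · obtain ⟨v, hv, hdom⟩ := ih hl'
      rcases dom_total a v with h | h
      · refine ⟨a, by simp, fun w hw => ?_⟩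
        rcases List.mem_cons.1 hw with rfl | hw
        · exact dom_refl _
        · exact dom_trans h (hdom w hw)
      · refine ⟨v, List.mem_cons_of_mem _ hv, fun w hw => ?_⟩
        rcases List.mem_cons.1 hw with rfl | hw
        · exact h
        · exact hdom w hw

/-- **The top vertex** of a (nonempty) list. [cite: MadrasSlade1993, §7.2 (Fig. 7.1)] -/
def top (l : List HV) : HV :=
  if h : l ≠ [] then Classical.choose (exists_top l h) else hvOrigin

/-- The top vertex is a member. [folklore] -/
private theorem top_mem {l : List HV} (hl : l ≠ []) : top l ∈ l := by
  rw [top, dif_pos hl]; exact (Classical.choose_spec (exists_top l hl)).1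

/-- The top vertex dominates every member. [folklore] -/
private theorem top_dom {l : List HV} (hl : l ≠ []) : ∀ w ∈ l, Dom (top l) w := by
  rw [top, dif_pos hl]; exact (Classical.choose_spec (exists_top l hl)).2

/-- Characterisation of the top vertex. [folklore] -/
private theorem top_eq_of {l : List HV} {v : HV} (hv : v ∈ l) (hdom : ∀ w ∈ l, Dom v w) : top l = v := by
  have hl : l ≠ [] := List.ne_nil_of_mem hv
  exact dom_antisymm (top_dom hl v hv) (hdom _ (top_mem hl))

/-! ### §2. Neighbours of a dominating vertex -/

/-- A neighbour `a` of `u` dominated by `u`: if `u = (x, false)` then `a ∈ {(x − e₀, true), (x − e₁, true)}`; if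
`u = (x, true)` then `a = (x, false)`. [cite: MadrasSlade1993, §7.2 (Fig. 7.1)] -/
theorem neighbour_cases {u a : HV} (hadj : hvGraph.Adj u a) (hdom : Dom u a) :
    (u.2.2 = false ∧ (a = (u.1 - 1, u.2.1, true) ∨ a = (u.1, u.2.1 - 1, true))) ∨
      (u.2.2 = true ∧ a = (u.1, u.2.1, false)) := by
  obtain ⟨x0, x1, b⟩ := u
  obtain ⟨y0, y1, b'⟩ := a
  rw [hvGraph_adj] at hadj
  unfold Dom lev at hdom
  cases b <;> cases b' <;> simp [HV.AdjRel] at hadj hdom ⊢ <;> omega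

/-- Adjacency of `hvGraph` from the arithmetic relation. [folklore] -/
private theorem adj_of (u v : HV) (h : HV.AdjRel u v) : hvGraph.Adj u v := (hvGraph_adj u v).2 h

/-! ### §3. Generic list surgery -/

section Insert

variable {V : Type*} {G : SimpleGraph V} {v : V} {n : ℕ}

/-- **Inserting a fresh self-avoiding path between two consecutive vertices of a self-avoiding list**, its ends adjacent
to the two vertices, gives a self-avoiding list longer by the length of the path. [cite: MadrasSlade1993, §7.2 (Fig. 7.1)] -/
theorem insertPath_mem_sawLists {l₁ l₂ p : List V} (h : l₁ ++ l₂ ∈ sawLists G v n) (h1 : l₁ ≠ [])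
    (hp : p.IsChain G.Adj) (hpn : p.Nodup) (hdis : ∀ z ∈ p, z ∉ l₁ ++ l₂)
    (ha : ∀ a ∈ l₁.getLast?, ∀ z ∈ p.head?, G.Adj a z) (hb : ∀ z ∈ p.getLast?, ∀ b ∈ l₂.head?, G.Adj z b)
    (hpne : p ≠ []) : l₁ ++ p ++ l₂ ∈ sawLists G v (n + p.length) := by
  obtain ⟨hch, hhead, hlen, hnd⟩ := h
  refine ⟨?_, ?_, ?_, ?_⟩
  · rw [List.isChain_append] at hch
    obtain ⟨hc1, hc2, h12⟩ := hch
    rw [List.isChain_append, List.isChain_append]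
    refine ⟨⟨hc1, hp, ha⟩, hc2, fun x hx y hy => ?_⟩
    rw [List.getLast?_append, Option.mem_def, Option.or_eq_some_iff] at hx
    rcases hx with hx | ⟨hnone, -⟩
    · exact hb x hx y hy
    · exact absurd (List.getLast?_eq_none_iff.1 hnone) hpne
  · rw [List.append_assoc, List.head?_append_of_ne_nil _ h1]
    rw [List.head?_append_of_ne_nil _ h1] at hhead
    exact hhead
  · simp only [List.length_append] at hlen ⊢; omega
  · rw [List.nodup_append] at hnd
    obtain ⟨hn1, hn2, hn12⟩ := hnd
    rw [List.nodup_append, List.nodup_append]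
    refine ⟨⟨hn1, hpn, fun a ha' z hz heq => hdis z hz (heq ▸ List.mem_append_left _ ha')⟩, hn2,
      fun x hx b hb' heq => ?_⟩
    rcases List.mem_append.1 hx with hx | hx
    · exact hn12 x hx b hb' heq
    · exact hdis x hx (heq ▸ List.mem_append_right _ hb')

/-- Filtering with a predicate true on the outer lists and false on the inserted path recovers the list.
[folklore] -/
private theorem filter_insertPath {l₁ l₂ p : List V} (f : V → Bool) (h12 : ∀ z ∈ l₁ ++ l₂, f z = true)
    (hp : ∀ z ∈ p, f z = false) : (l₁ ++ p ++ l₂).filter f = l₁ ++ l₂ := by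
  rw [List.filter_append, List.filter_append,
    List.filter_eq_self.2 fun z hz => h12 z (List.mem_append_left _ hz),
    List.filter_eq_self.2 fun z hz => h12 z (List.mem_append_right _ hz),
    (List.filter_eq_nil_iff (l := p)).2 fun z hz => by simp [hp z hz], List.append_nil]

end Insert

/-! ### §4. The three gadgets -/

/-- The level of the origin is `0`. [folklore] -/
private theorem lev_origin : lev hvOrigin = 0 := by simp [lev, hvOrigin]

/-- Translation by `−2e₀` (levels drop by `4`). [cite: MadrasSlade1993, §7.2 (Fig. 7.1)] -/
def sh (v : HV) : HV := (v.1 - 2, v.2.1, v.2.2)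

/-- Its inverse. [cite: MadrasSlade1993, §7.2 (Fig. 7.1)] -/
def unsh (v : HV) : HV := (v.1 + 2, v.2.1, v.2.2)

/-- `lev (sh w) = lev w − 4`. [folklore] -/
private theorem lev_sh (w : HV) : lev (sh w) = lev w - 4 := by unfold lev sh; simp; ring

/-- `sh` preserves adjacency. [folklore] -/
private theorem sh_adj {a b : HV} (h : hvGraph.Adj a b) : hvGraph.Adj (sh a) (sh b) := by
  obtain ⟨a0, a1, ab⟩ := a; obtain ⟨b0, b1, bb⟩ := b
  rw [hvGraph_adj] at h ⊢
  cases ab <;> cases bb <;> simp [HV.AdjRel, sh] at h ⊢ <;> omega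

/-- `sh` is injective. [folklore] -/
private theorem sh_injective : Function.Injective sh := fun a b hab => by
  obtain ⟨a0, a1, ab⟩ := a; obtain ⟨b0, b1, bb⟩ := b
  simp only [sh, Prod.mk.injEq] at hab
  obtain ⟨h0, h1, hb⟩ := hab
  simp only [Prod.mk.injEq]
  exact ⟨by omega, h1, hb⟩

/-- The 4-vertex prefix from the origin down to level `−3`, ending next to `sh hvOrigin = (−2, 0, false)`. [cite: MadrasSlade1993, §7.2 (Fig. 7.1)] -/
def pre4 : List HV := [(0, 0, false), (-1, 0, true), (-1, 0, false), (-2, 0, true)]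

/-- `pre4` is a self-avoiding chain from the origin whose last vertex is adjacent to `sh hvOrigin`, with levels in
`[-3, 0]` and the origin its only vertex of level `0`. [folklore] -/
private theorem pre4_facts :
    pre4.IsChain hvGraph.Adj ∧ pre4.Nodup ∧ pre4.head? = some hvOrigin ∧ pre4.length = 4 ∧
      (∀ x ∈ pre4.getLast?, hvGraph.Adj x (sh hvOrigin)) ∧
      (∀ z ∈ pre4, -3 ≤ lev z ∧ (lev z < 0 ∨ z = hvOrigin)) := by
  refine ⟨?_, by simp [pre4], by simp [pre4, hvOrigin], by simp [pre4], ?_, ?_⟩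
  · simp only [pre4, List.isChain_cons_cons, List.IsChain.singleton, and_true]
    refine ⟨adj_of _ _ ?_, adj_of _ _ ?_, adj_of _ _ ?_⟩ <;> simp [HV.AdjRel]
  · intro x hx
    simp only [pre4, List.getLast?_cons_cons, List.getLast?_singleton, Option.mem_def, Option.some.injEq] at hx
    subst hx
    exact adj_of _ _ (by simp [HV.AdjRel, sh, hvOrigin])
  · intro z hz
    simp only [pre4, List.mem_cons, List.not_mem_nil, or_false] at hz
    rcases hz with rfl | rfl | rfl | rfl <;> simp [lev, hvOrigin]

/-- The 4-vertex climb above `u` (levels `lev u + 1, …, lev u + 4`), ending at `u + 2e₀`. [cite: MadrasSlade1993, §7.2 (Fig. 7.1)] -/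
def up4 (u : HV) : List HV :=
  if u.2.2 then [(u.1 + 1, u.2.1, false), (u.1 + 1, u.2.1, true), (u.1 + 2, u.2.1, false), (u.1 + 2, u.2.1, true)]
  else [(u.1, u.2.1, true), (u.1 + 1, u.2.1, false), (u.1 + 1, u.2.1, true), (u.1 + 2, u.2.1, false)]

/-- The climb is a self-avoiding chain of length `4` attached to `u`, ending at `u + 2e₀` (level `lev u + 4`), all
its other vertices having levels in `(lev u, lev u + 4)`. [folklore] -/
private theorem up4_facts (u : HV) :
    (up4 u).IsChain hvGraph.Adj ∧ (up4 u).Nodup ∧ (up4 u).length = 4 ∧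
      (∀ z ∈ (up4 u).head?, hvGraph.Adj u z) ∧ (up4 u).getLast? = some (u.1 + 2, u.2.1, u.2.2) ∧
      lev (u.1 + 2, u.2.1, u.2.2) = lev u + 4 ∧
      (∀ z ∈ up4 u, lev u < lev z ∧ (lev z < lev u + 4 ∨ z = (u.1 + 2, u.2.1, u.2.2))) := by
  obtain ⟨x0, x1, b⟩ := u
  cases b
  all_goals
    refine ⟨?_, ?_, by simp [up4], ?_, by simp [up4], by simp [lev]; ring, ?_⟩
    · simp only [up4, if_true, Bool.false_eq_true, if_false, List.isChain_cons_cons, List.IsChain.singleton,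
        and_true]
      refine ⟨adj_of _ _ ?_, adj_of _ _ ?_, adj_of _ _ ?_⟩ <;> (simp [HV.AdjRel] <;> omega)
    · simp [up4]
    · intro z hz
      simp [up4] at hz
      subst hz
      exact adj_of _ _ (by simp [HV.AdjRel])
    · intro z hz
      simp [up4] at hz
      rcases hz with rfl | rfl | rfl | rfl <;> simp [lev] <;> omega

/-- The hexagon detour at `u = (a, false)`: the 4-path from the upper neighbour `(a, true)` of `u` to the vertex
`(a + e₀ − e₁, false)` adjacent to `(a − e₁, true)`. [cite: MadrasSlade1993, §7.2 (Fig. 7.1)] -/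
def det4 (u : HV) : List HV :=
  [(u.1, u.2.1, true), (u.1 + 1, u.2.1, false), (u.1 + 1, u.2.1 - 1, true), (u.1 + 1, u.2.1 - 1, false)]

/-- The detour is a self-avoiding chain of length `4`; its head is adjacent to `u` (of type `false`), its last vertex to
`(a − e₁, true)`; its vertices are the apex `(a + e₀, false)` (level `lev u + 2`), two vertices of level `lev u + 1`, and
`(a + e₀ − e₁, false)` (level `lev u`, abscissa `u.1 + 1`). [folklore] -/
private theorem det4_facts (u : HV) (hF : u.2.2 = false) :
    (det4 u).IsChain hvGraph.Adj ∧ (det4 u).Nodup ∧ (det4 u).length = 4 ∧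
      (det4 u).head? = some (u.1, u.2.1, true) ∧ (det4 u).getLast? = some (u.1 + 1, u.2.1 - 1, false) ∧
      hvGraph.Adj u (u.1, u.2.1, true) ∧ hvGraph.Adj (u.1 + 1, u.2.1 - 1, false) (u.1, u.2.1 - 1, true) ∧
      lev (u.1 + 1, u.2.1, false) = lev u + 2 ∧ (u.1 + 1, u.2.1, false) ∈ det4 u ∧
      (∀ z ∈ det4 u, (lev u < lev z ∧ lev z < lev u + 2) ∨ z = (u.1 + 1, u.2.1, false) ∨
        (lev z = lev u ∧ z.1 = u.1 + 1)) := by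
  obtain ⟨x0, x1, b⟩ := u
  simp only at hF; subst hF
  refine ⟨?_, by simp [det4]; omega, by simp [det4], by simp [det4], by simp [det4], adj_of _ _ (by simp [HV.AdjRel]),
    adj_of _ _ (by simp [HV.AdjRel]), by simp [lev]; ring, by simp [det4], ?_⟩
  · simp only [det4, List.isChain_cons_cons, List.IsChain.singleton, and_true]
    refine ⟨adj_of _ _ ?_, adj_of _ _ ?_, adj_of _ _ ?_⟩ <;> simp [HV.AdjRel]
  · intro z hz
    simp [det4] at hz
    rcases hz with rfl | rfl | rfl | rfl <;> simp [lev]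

/-! ### §5. The growth map and its decoder -/

/-- **The growth map `ω ↦ ω⁺⁴`**. [cite: MadrasSlade1993, §7.2 (Fig. 7.1)] -/
def grow4 (ω : List HV) : List HV :=
  if ω.idxOf (top ω) = 0 then pre4 ++ ω.map sh
  else if ω.idxOf (top ω) + 1 = ω.length then ω ++ up4 (top ω)
  else if ω[ω.idxOf (top ω) + 1]? = some ((top ω).1, (top ω).2.1 - 1, true) then
    ω.take (ω.idxOf (top ω) + 1) ++ det4 (top ω) ++ ω.drop (ω.idxOf (top ω) + 1)
  else ω.take (ω.idxOf (top ω)) ++ (det4 (top ω)).reverse ++ ω.drop (ω.idxOf (top ω))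

/-- **The decoder**: read the case off the top vertex of the image. [cite: MadrasSlade1993, §7.2 (Fig. 7.1)] -/
def ungrow4 (ω : List HV) : List HV :=
  if top ω = hvOrigin then (ω.drop 4).map unsh
  else if ω.getLast? = some (top ω) then ω.take (ω.length - 4)
  else ω.filter fun z => decide (z ∉ det4 ((top ω).1 - 1, (top ω).2.1, false))

/-- `(l.take i).getLast? = l[i-1]?` for `1 ≤ i ≤ |l|`. [folklore] -/
private theorem getLast?_take {α : Type*} (l : List α) {i : ℕ} (hi : 1 ≤ i) (hil : i ≤ l.length) :
    (l.take i).getLast? = l[i - 1]? := by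
  rw [List.getLast?_eq_getElem?, List.length_take, min_eq_left hil, List.getElem?_take]
  simp [show i - 1 < i by omega]

/-- **The growth map is well defined and decoded by `ungrow4`.** [cite: MadrasSlade1993, §7.2 (Fig. 7.1)] -/
theorem grow4_spec {N : ℕ} {ω : List HV} (hω : ω ∈ sawLists hvGraph hvOrigin N) :
    grow4 ω ∈ sawLists hvGraph hvOrigin (N + 4) ∧ ungrow4 (grow4 ω) = ω := by
  obtain ⟨hch, hhead, hlen, hnd⟩ := id hω
  have hne : ω ≠ [] := by rintro rfl; simp at hlen
  have humem : top ω ∈ ω := top_mem hne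
  have hudom : ∀ w ∈ ω, Dom (top ω) w := top_dom hne
  have hilt : ω.idxOf (top ω) < ω.length := List.idxOf_lt_length_iff.2 humem
  have hωi : ω[ω.idxOf (top ω)]? = some (top ω) := List.getElem?_idxOf humem
  generalize hu : top ω = u at humem hudom hilt hωi
  generalize hi : ω.idxOf u = i at hilt hωi
  have hgrow : grow4 ω =
      if i = 0 then pre4 ++ ω.map sh
      else if i + 1 = ω.length then ω ++ up4 u
      else if ω[i + 1]? = some (u.1, u.2.1 - 1, true) then ω.take (i + 1) ++ det4 u ++ ω.drop (i + 1)
      else ω.take i ++ (det4 u).reverse ++ ω.drop i := by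
    rw [grow4, hu, hi]
  have h0mem : hvOrigin ∈ ω := List.mem_of_mem_head? (by rw [hhead]; rfl)
  have hlevO : 0 ≤ lev u := by
    have h := hudom _ h0mem; unfold Dom at h; rw [lev_origin] at h; omega
  have hadj : ∀ j (hj : j + 1 < ω.length), hvGraph.Adj ω[j] ω[j + 1] := List.isChain_iff_getElem.1 hch
  have hinj : ∀ j k (hj : j < ω.length) (hk : k < ω.length), ω[j] = ω[k] → j = k :=
    fun j k hj hk h => (hnd.getElem_inj_iff).1 h
  have hu' : ω[i]'hilt = u := by
    rw [List.getElem?_eq_getElem hilt] at hωi; exact Option.some.inj hωi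
  by_cases hi0 : i = 0
  · ----------------------------------------------------------------- case (i): the origin is the top vertex
    subst hi0
    have hu0 : u = hvOrigin := by
      have h1 := hωi
      rw [← List.head?_eq_getElem?, hhead] at h1
      exact (Option.some.inj h1).symm
    subst hu0
    have hg : grow4 ω = pre4 ++ ω.map sh := by rw [hgrow, if_pos rfl]
    obtain ⟨pch, pnd, phead, plen, plast, plev⟩ := pre4_facts
    have hlevω : ∀ w ∈ ω, lev w ≤ 0 := fun w hw => by
      have h := hudom w hw; unfold Dom at h; rw [lev_origin] at h; omega
    have hmem : pre4 ++ ω.map sh ∈ sawLists hvGraph hvOrigin (N + 4) := by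
      refine ⟨?_, by rw [List.head?_append_of_ne_nil _ (by simp [pre4]), phead], by simp [plen, hlen]; omega, ?_⟩
      · rw [List.isChain_append]
        refine ⟨pch, (List.isChain_map _).2 (hch.imp fun a b h => sh_adj h), fun x hx y hy => ?_⟩
        rw [List.head?_map, hhead] at hy
        simp only [Option.map_some, Option.mem_def, Option.some.injEq] at hy
        subst hy
        exact plast x hx
      · rw [List.nodup_append]
        refine ⟨pnd, hnd.map sh_injective, fun a ha b hb hab => ?_⟩
        obtain ⟨w, hw, rfl⟩ := List.mem_map.1 hb
        have h1 := hlevω w hw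
        have h2 := lev_sh w
        have h3 := (plev a ha).1
        rw [hab] at h3; omega
    have htop : top (pre4 ++ ω.map sh) = hvOrigin := by
      refine top_eq_of (List.mem_append_left _ (List.mem_of_mem_head? (by rw [phead]; rfl))) fun w hw => ?_
      rcases List.mem_append.1 hw with hw | hw
      · rcases (plev w hw).2 with h | rfl
        · left; rw [lev_origin]; exact h
        · exact dom_refl _
      · obtain ⟨w', hw', rfl⟩ := List.mem_map.1 hw
        have h1 := hlevω w' hw'
        have h2 := lev_sh w'
        left; rw [lev_origin]; omega
    refine ⟨hg ▸ hmem, ?_⟩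
    rw [hg, ungrow4, if_pos htop]
    rw [show (pre4 ++ ω.map sh).drop 4 = ω.map sh by rw [List.drop_append_of_le_length (by simp [plen]),
      show pre4.drop 4 = [] by simp [pre4], List.nil_append], List.map_map]
    convert List.map_id ω
    funext w
    simp [sh, unsh]
  · ----------------------------------------------------------------- `u` is not the first vertex
    have hi1 : 1 ≤ i := Nat.one_le_iff_ne_zero.2 hi0
    have huO : u ≠ hvOrigin := by
      intro h
      have h1 : ω[0]'(by omega) = u := by
        have := List.head?_eq_getElem? (l := ω)
        rw [hhead, List.getElem?_eq_getElem (show 0 < ω.length by omega)] at this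
        rw [h]; exact (Option.some.inj this).symm
      have := hinj 0 i (by omega) hilt (by rw [h1, hu'])
      omega
    -- the predecessor `a`
    obtain ⟨a, ha⟩ : ∃ a, ω[i - 1]? = some a := ⟨ω[i - 1], List.getElem?_eq_getElem (by omega)⟩
    have hi1' : i - 1 < ω.length := by omega
    have ha' : ω[i - 1]'hi1' = a := by
      rw [List.getElem?_eq_getElem hi1'] at ha; exact Option.some.inj ha
    have hamem : a ∈ ω := by rw [← ha']; exact List.getElem_mem _
    have hau : hvGraph.Adj a u := by
      have := hadj (i - 1) (by omega)
      simp only [Nat.sub_add_cancel hi1] at this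
      rwa [hu', ha'] at this
    have ha3 := neighbour_cases hau.symm (hudom a hamem)
    by_cases hlast : i + 1 = ω.length
    · --------------------------------------------------------------- cases (ii)/(iii): `u` is the last vertex
      have hg : grow4 ω = ω ++ up4 u := by rw [hgrow, if_neg hi0, if_pos hlast]
      have hωlast : ω.getLast? = some u := by
        rw [List.getLast?_eq_getElem?, ← hlast, Nat.add_sub_cancel, hωi]
      obtain ⟨uch, und, ulen, uhead, ulast, tlev, ulev⟩ := up4_facts u
      have hup_fresh : ∀ z ∈ up4 u, z ∉ ω := fun z hz hzω => by
        have h1 := (ulev z hz).1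
        have h2 := hudom z hzω
        unfold Dom at h2; omega
      have hmem : ω ++ up4 u ∈ sawLists hvGraph hvOrigin (N + 4) := by
        have h := insertPath_mem_sawLists (G := hvGraph) (v := hvOrigin) (n := N) (l₁ := ω) (l₂ := [])
          (p := up4 u) (by rwa [List.append_nil]) hne uch und
          (fun z hz => by rw [List.append_nil]; exact hup_fresh z hz)
          (fun x hx z hz => by
            rw [hωlast] at hx
            simp only [Option.mem_def, Option.some.injEq] at hx
            subst hx; exact uhead z hz)
          (by simp) (by rintro h; simp [h] at ulen)
        rwa [List.append_nil, ulen] at h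
      have htop : top (ω ++ up4 u) = (u.1 + 2, u.2.1, u.2.2) := by
        refine top_eq_of (List.mem_append_right _ (List.mem_of_getLast? ulast)) fun w hw => ?_
        rcases List.mem_append.1 hw with hw | hw
        · have := hudom w hw; unfold Dom at this ⊢; omega
        · rcases (ulev w hw).2 with h | rfl
          · unfold Dom; omega
          · exact dom_refl _
      have htO : ((u.1 + 2, u.2.1, u.2.2) : HV) ≠ hvOrigin := by
        intro h; have h1 := tlev; rw [h, lev_origin] at h1; omega
      refine ⟨hg ▸ hmem, ?_⟩
      rw [hg, ungrow4, htop, if_neg htO, if_pos (by rw [List.getLast?_append, ulast]; rfl)]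
      rw [List.length_append, ulen, Nat.add_sub_cancel, List.take_left']
      rfl
    · --------------------------------------------------------------- case (iv): `u` is interior
      have hi2 : i + 1 < ω.length := by omega
      obtain ⟨b, hb⟩ : ∃ b, ω[i + 1]? = some b := ⟨ω[i + 1], List.getElem?_eq_getElem hi2⟩
      have hb'' : ω[i + 1]'hi2 = b := by
        rw [List.getElem?_eq_getElem hi2] at hb; exact Option.some.inj hb
      have hbmem : b ∈ ω := by rw [← hb'']; exact List.getElem_mem _
      have hub : hvGraph.Adj u b := by have := hadj i hi2; rwa [hu', hb''] at this
      have hb3 := neighbour_cases hub (hudom b hbmem)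
      have hab : a ≠ b := by
        intro h
        have := hinj (i - 1) (i + 1) hi1' hi2 (by rw [ha', hb'', h])
        omega
      -- `u` is of type `false`, and `{a, b} ⊆ {(u−e₀, T), (u−e₁, T)}`
      have huF : u.2.2 = false := by
        rcases ha3 with ⟨h, -⟩ | ⟨-, ha⟩
        · exact h
        · rcases hb3 with ⟨h, -⟩ | ⟨-, hb⟩
          · exact h
          · exact absurd (ha.trans hb.symm) hab
      have ha2 : a = (u.1 - 1, u.2.1, true) ∨ a = (u.1, u.2.1 - 1, true) := by
        rcases ha3 with ⟨-, h⟩ | ⟨hT, -⟩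
        · exact h
        · rw [huF] at hT; exact absurd hT (by simp)
      have hb2 : b = (u.1 - 1, u.2.1, true) ∨ b = (u.1, u.2.1 - 1, true) := by
        rcases hb3 with ⟨-, h⟩ | ⟨hT, -⟩
        · exact h
        · rw [huF] at hT; exact absurd hT (by simp)
      obtain ⟨dch, dnd, dlen, dhead, dlast, dadj1, dadj2, tlev, tmem, dlev⟩ := det4_facts u huF
      have hdet_fresh : ∀ z ∈ det4 u, z ∉ ω := by
        intro z hz hzω
        have h2 := hudom z hzω
        unfold Dom at h2
        rcases dlev z hz with h1 | rfl | h1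
        · omega
        · omega
        · omega
      have htO : ((u.1 + 1, u.2.1, false) : HV) ≠ hvOrigin := by
        intro h; have h1 := tlev; rw [h, lev_origin] at h1; omega
      have htω : ((u.1 + 1, u.2.1, false) : HV) ∉ ω := hdet_fresh _ tmem
      have hdecode : (((u.1 + 1, u.2.1, false) : HV).1 - 1, ((u.1 + 1, u.2.1, false) : HV).2.1, false) = u := by
        obtain ⟨x0, x1, bb⟩ := u; simp only at huF; subst huF; simp
      -- the top of `l₁ ++ q ++ l₂` (`q` a rearrangement of the detour, `l₁ ++ l₂ = ω`) is the apex
      have htop_of : ∀ (l₁ l₂ q : List HV), ω = l₁ ++ l₂ → (∀ z, z ∈ q ↔ z ∈ det4 u) →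
          top (l₁ ++ q ++ l₂) = (u.1 + 1, u.2.1, false) := by
        intro l₁ l₂ q hωl hq
        refine top_eq_of (List.mem_append_left _ (List.mem_append_right _ ((hq _).2 tmem))) fun w hw => ?_
        rw [List.append_assoc, List.mem_append, List.mem_append] at hw
        rcases hw with hw | hw | hw
        · have := hudom w (hωl ▸ List.mem_append_left _ hw); unfold Dom at this ⊢; omega
        · rcases dlev w ((hq w).1 hw) with h1 | rfl | h1
          · unfold Dom; omega
          · exact dom_refl _
          · unfold Dom; simp only; omega
        · have := hudom w (hωl ▸ List.mem_append_right _ hw); unfold Dom at this ⊢; omega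
      -- the generic conclusion
      have conclude : ∀ (l₁ l₂ q : List HV), ω = l₁ ++ l₂ → l₁ ≠ [] → l₂ ≠ [] → (∀ z, z ∈ q ↔ z ∈ det4 u) →
          q.IsChain hvGraph.Adj → q.Nodup → q.length = 4 →
          (∀ x ∈ l₁.getLast?, ∀ z ∈ q.head?, hvGraph.Adj x z) →
          (∀ z ∈ q.getLast?, ∀ y ∈ l₂.head?, hvGraph.Adj z y) →
          grow4 ω = l₁ ++ q ++ l₂ →
          grow4 ω ∈ sawLists hvGraph hvOrigin (N + 4) ∧ ungrow4 (grow4 ω) = ω := by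
        intro l₁ l₂ q hωl hl₁ hl₂ hq hqc hqn hql hqa hqb hg
        have hdis : ∀ z ∈ q, z ∉ l₁ ++ l₂ := fun z hz => hωl ▸ hdet_fresh z ((hq z).1 hz)
        have hmem : l₁ ++ q ++ l₂ ∈ sawLists hvGraph hvOrigin (N + 4) := by
          have h := insertPath_mem_sawLists (hωl ▸ hω) hl₁ hqc hqn hdis hqa hqb
            (by rintro rfl; simp at hql)
          rwa [hql] at h
        have htop := htop_of l₁ l₂ q hωl hq
        refine ⟨hg ▸ hmem, ?_⟩
        rw [hg, ungrow4, htop, if_neg htO, if_neg, hdecode]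
        · rw [filter_insertPath _ (fun z hz => ?_) (fun z hz => ?_), ← hωl]
          · rw [decide_eq_true_eq]
            exact fun hzq => hdis z ((hq z).2 hzq) hz
          · rw [decide_eq_false_iff_not, not_not]
            exact (hq z).1 hz
        · rw [List.append_assoc, List.getLast?_append]
          obtain ⟨y, hy⟩ : ∃ y, l₂.getLast? = some y := by
            rw [List.getLast?_eq_some_getLast hl₂]; exact ⟨_, rfl⟩
          rw [List.getLast?_append, hy]
          simp only [Option.some_or, Option.some.injEq]
          intro hyt
          have : y ∈ ω := hωl ▸ List.mem_append_right _ (List.mem_of_getLast? hy)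
          exact htω (hyt ▸ this)
      -- splitting data
      have hsplit1 : ω = ω.take i ++ ω.drop i := (List.take_append_drop i ω).symm
      have hsplit2 : ω = ω.take (i + 1) ++ ω.drop (i + 1) := (List.take_append_drop (i + 1) ω).symm
      have hlast1 : (ω.take i).getLast? = some a := by rw [getLast?_take ω hi1 hilt.le, ha]
      have hlast2 : (ω.take (i + 1)).getLast? = some u := by
        rw [List.take_succ_eq_append_getElem hilt, hu', List.getLast?_concat]
      have hhead1 : (ω.drop i).head? = some u := by rw [List.head?_drop, hωi]
      have hhead2 : (ω.drop (i + 1)).head? = some b := by rw [List.head?_drop, hb]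
      have hne1 : ω.take i ≠ [] := by
        intro h; rw [List.take_eq_nil_iff] at h
        rcases h with h | h
        · exact hi0 h
        · exact hne h
      have hne2 : ω.take (i + 1) ≠ [] := by
        intro h; rw [List.take_eq_nil_iff] at h
        rcases h with h | h
        · omega
        · exact hne h
      have hne3 : ω.drop (i + 1) ≠ [] := by rw [ne_eq, List.drop_eq_nil_iff]; omega
      have hne4 : ω.drop i ≠ [] := by rw [ne_eq, List.drop_eq_nil_iff]; omega
      by_cases hbr : ω[i + 1]? = some (u.1, u.2.1 - 1, true)
      · -- insert after `u`
        have hg : grow4 ω = ω.take (i + 1) ++ det4 u ++ ω.drop (i + 1) := by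
          rw [hgrow, if_neg hi0, if_neg hlast, if_pos hbr]
        have hbeq : b = (u.1, u.2.1 - 1, true) := by
          rw [hb] at hbr; exact Option.some.inj hbr
        refine conclude _ _ _ hsplit2 hne2 hne3 (fun z => Iff.rfl) dch dnd dlen
          (fun x hx z hz => ?_) (fun z hz y hy => ?_) hg
        · rw [hlast2] at hx; rw [dhead] at hz
          simp only [Option.mem_def, Option.some.injEq] at hx hz
          subst hx; subst hz; exact dadj1
        · rw [dlast] at hz; rw [hhead2, hbeq] at hy
          simp only [Option.mem_def, Option.some.injEq] at hz hy
          subst hz; subst hy; exact dadj2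
      · -- insert before `u` (then `a = (u − e₁, true)`)
        have hg : grow4 ω = ω.take i ++ (det4 u).reverse ++ ω.drop i := by
          rw [hgrow, if_neg hi0, if_neg hlast, if_neg hbr]
        have hbne : b ≠ (u.1, u.2.1 - 1, true) := fun h => hbr (by rw [hb, h])
        have haeq : a = (u.1, u.2.1 - 1, true) := by
          rcases hb2 with hb2 | hb2
          · rcases ha2 with ha2 | ha2
            · exact absurd (ha2.trans hb2.symm) hab
            · exact ha2
          · exact absurd hb2 hbne
        refine conclude _ _ _ hsplit1 hne1 hne4 (fun z => List.mem_reverse)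
          (List.isChain_reverse.2 (dch.imp fun x y h => h.symm)) (List.nodup_reverse.2 dnd) (by simp [dlen])
          (fun x hx z hz => ?_) (fun z hz y hy => ?_) hg
        · rw [hlast1, haeq] at hx; rw [List.head?_reverse, dlast] at hz
          simp only [Option.mem_def, Option.some.injEq] at hx hz
          subst hx; subst hz; exact dadj2.symm
        · rw [List.getLast?_reverse, dhead] at hz; rw [hhead1] at hy
          simp only [Option.mem_def, Option.some.injEq] at hz hy
          subst hz; subst hy; exact dadj1.symm

/-- **The growth map is injective on `N`-step self-avoiding lists** (it has the left inverse `ungrow4`).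
[cite: MadrasSlade1993, §7.2 (Fig. 7.1)] -/
theorem grow4_injOn (N : ℕ) : Set.InjOn grow4 (sawLists hvGraph hvOrigin N) := by
  intro ω₁ h₁ ω₂ h₂ h
  rw [← (grow4_spec h₁).2, ← (grow4_spec h₂).2, h]

end HexP4

open HexP4 in
/-- **`c_N(ℍ) ≤ c_{N+4}(ℍ)`** on the hexagonal lattice: the growth map `grow4` is an injection from the `N`-step
self-avoiding walks into the `(N+4)`-step ones. [cite: MadrasSlade1993, §7.2 (Fig. 7.1), §7.1 (7.1.6)] -/
theorem hexSawCount_le_add_four (N : ℕ) : hexSawCount N ≤ hexSawCount (N + 4) := by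
  rw [hexSawCount_eq_ncard, hexSawCount_eq_ncard]
  exact Set.ncard_le_ncard_of_injOn grow4 (fun ω hω => (grow4_spec hω).1) (grow4_injOn N)
    (Set.finite_of_ncard_pos (by rw [← hexSawCount_eq_ncard]; exact hexSawCount_pos _))

/-- Lane face K3-ℍ «HEX-PLUS-FOUR» (a-idea-1 `Doors_Day3` §C1, verbatim). [cite: MadrasSlade1993, §7.1 (7.1.6)] -/
def HexPlusFour : Prop := ∀ N : ℕ, hexSawCount N ≤ hexSawCount (N + 4)

/-- **K3-ℍ holds.** [cite: MadrasSlade1993, §7.2 (Fig. 7.1)] -/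
theorem hexPlusFour : HexPlusFour := hexSawCount_le_add_four

/-- Lane face «HEX-RATIO-LOWER» (a-idea-1 `Doors_Day3` §C1, verbatim): the two-step ratios `c_{N+2}(ℍ)/c_N(ℍ)` are
bounded below — hypothesis (ii) of Kesten's Lemma 7.3.1 for `a_N = c_N(ℍ)`. [cite: MadrasSlade1993, Lemma 7.3.1] -/
def HexRatioLower : Prop := ∃ c : ℝ, 0 < c ∧ ∀ N : ℕ, c ≤ (hexSawCount (N + 2) : ℝ) / hexSawCount N

/-- **K3-ℍ ⇒ (ii)**, with `c = 1/c_2(ℍ)`: `c_N ≤ c_{N+4} ≤ c_{N+2} c_2` (a-idea-1's glue `hexRatioLower_of_plusFour`,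
proof verbatim). [cite: MadrasSlade1993, Lemma 7.3.1, §1.2 (1.2.3)] -/
theorem hexRatioLower : HexRatioLower := by
  refine ⟨1 / hexSawCount 2, by have := hexSawCount_pos 2; positivity, fun N => ?_⟩
  have h0 : (0 : ℝ) < hexSawCount N := by exact_mod_cast hexSawCount_pos N
  have hc2 : (0 : ℝ) < hexSawCount 2 := by exact_mod_cast hexSawCount_pos 2
  have h4 : (hexSawCount N : ℝ) ≤ hexSawCount (N + 2) * hexSawCount 2 := by
    have a := hexSawCount_le_add_four N
    have b := hexSawCount_add_le (N + 2) 2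
    exact_mod_cast a.trans b
  rw [div_le_div_iff₀ hc2 h0, one_mul]
  exact h4

/-! ### Exact-name discharges of the two faces (facts-census riders; lane rule r68: same file, exact name) -/

/-- Discharge of the named face `HexPlusFour` under its census name. [cite: MadrasSlade1993, §7.2 (Fig. 7.1)] -/
theorem HexPlusFour_holds : HexPlusFour := hexPlusFour

/-- Discharge of the named face `HexRatioLower` under its census name. [cite: MadrasSlade1993, Lemma 7.3.1, §1.2 (1.2.3)] -/
theorem HexRatioLower_holds : HexRatioLower := hexRatioLower

end Literature.Probability.RandomPlanarGeometry.SAW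

end
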